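import Literature.AlgebraicGeometry.Resolution.SmoothCoordinates
import Literature.FieldTheory.Separability.PIndependentDerivations
import Summits.ResolutionOfSingularities.ResolutionOfSingularities.Theorems.FrobeniusClosingSteerPBasisDual
import Mathlib.RingTheory.Kaehler.Basic
import Mathlib.LinearAlgebra.TensorProduct.Pi
import Mathlib.LinearAlgebra.StdBasis
import HarnessLib

/-!
# Crux `Steer` (stmt-ResolutionOfSingularities-16345), chain W4.1, hA3 Θ1♭ piece (L7), brick **(L7-Ω)**, part 1 of 2:
# the ENGINE — split injectivity of `e_l ↦ d(x, u)_l` over a formally smooth local algebra, and finite `p`-bases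
# with dual derivations of a field finitely generated over a perfect field

OURS (campaign `res-hironaka`, rung L ★L-G4, slot W4.1; seat res-L0-w41-stub-4 g6 on res-D-pv-004 (AS res-L0-w41-
stub-10)'s split 2026-08-27T10:43:42Z «you take brick (L7-Ω) = step (a)»; replaces the role of no printed item; NOT a
statement of the manuscript under review [claim: Hironaka2017, status: under-review]; AI-produced, weaker than expert
review). Theses-free and definition-free. Part 2 (`FrobeniusClosingSteerMemberDerivationFrame.lean`) assembles the
𝔪-adapted derivation frame of a regular local ring essentially of finite type over a perfect field from this engine.

## Contents

* §0 `linearIndependent_of_dual`, `linearIndependent_D_of_dual` (dual functionals / dual derivations detect linear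
  independence, in particular of differentials `dz_j ∈ Ω_{K/k}`), `derivation_map_le_of_apply_mem` (a derivation
  sending generators of an ideal into the ideal preserves it).
* §1 ENGINE `exists_retraction_sum` (any field `k`): for `A` local, essentially of finite type and formally smooth
  over `k` with formally smooth residue field `K`, minimal generators `x : ι → 𝔪` and ANY `u : ι' → A` whose residues
  carry dual `k`-derivations `δ` of `K`, the `A`-linear map `A^{ι ⊕ ι'} → Ω_{A/k}`, `e_l ↦ d(x,u)_l`, is SPLIT
  injective. `Ω_{A/k}` is finite free over the local ring `A`, so it suffices that the fibre family
  `{1 ⊗ dx_i} ∪ {1 ⊗ du_j} ⊂ K ⊗_A Ω_{A/k}` is linearly independent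
  (`IsLocalRing.split_injective_iff_lTensor_residueField_injective`): the `x`-block is independent by the tree's
  `exists_retraction_of_formallySmooth` (`SmoothCoordinates.lean`, Jacobian criterion `K ⊗ 𝔪 ↪ K ⊗ Ω`), the
  `u`-block maps under `K ⊗_A Ω_{A/k} → Ω_{K/k}` to `{dū_j}`, independent by the dual functionals, and that map
  KILLS the `x`-block (`d x̄_i = d 0`), whence the two spans are disjoint. Composing a retraction with the coordinate
  projections and the universal derivation gives DUAL DERIVATIONS `∂_l ((x,u)_{l'}) = δ_{ll'}` (`exists_frame_of_dual`).
* §2 over a PERFECT field `k` of characteristic `p`: `ℤ`-derivations kill `k = k^p` (`derivation_algebraMap_eq_zero`),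
  so they are `k`-derivations (`exists_derivation_of_int`); a field `K` finitely generated over `k` has a finite
  `p`-basis `z` (`K = K^p(z)`, a `p`-free subset of a finite generating set — tree `PIndependentDerivations.lean` /
  `PBasisDual`) with dual `k`-derivations whose common kernel is exactly `K^p` (`exists_pBasis_dual`).

[cite: Matsumura1987, §30 Thm. 30.6 (ii) p. 240; §26 p. 202 and Thm. 26.5] [folklore]
bears_on: LADDER-RESOLUTION L ★L-G4 W4.1 (crux `Steer`, hA3 (L7)).
-/

noncomputable section

-- `Summit.<S>.<S>.…` duplicates the summit name by design (single-problem summit).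
set_option linter.dupNamespace false

open IsLocalRing TensorProduct KaehlerDifferential

namespace Summit.ResolutionOfSingularities.ResolutionOfSingularities.Theorems.SwitchingDichotomy.MemberDerivationFrame

open Literature.AlgebraicGeometry.Resolution Literature.FieldTheory.Separability

universe u v w w'

/-! ## §0 Linear algebra: duals detect independence; derivations and generators of an ideal -/

/-- A family with dual functionals (`φ_j (w_{j'}) = δ_{jj'}`) is linearly independent. [folklore] -/
theorem linearIndependent_of_dual {K : Type u} {M : Type v} [Field K] [AddCommGroup M] [Module K M]
    {ι' : Type w'} [Fintype ι'] [DecidableEq ι'] (w : ι' → M) (φ : ι' → M →ₗ[K] K)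
    (hφ : ∀ j j', φ j (w j') = if j' = j then 1 else 0) : LinearIndependent K w := by
  rw [Fintype.linearIndependent_iff]
  intro g hg j
  have h := congrArg (φ j) hg
  rw [map_sum, map_zero] at h
  rw [← h, eq_comm]
  calc ∑ j', φ j (g j' • w j') = ∑ j', (if j' = j then g j' else 0) := by
        refine Finset.sum_congr rfl fun j' _ => ?_
        rw [map_smul, hφ j, smul_eq_mul]
        split_ifs <;> simp
    _ = g j := by rw [Finset.sum_ite_eq', if_pos (Finset.mem_univ j)]

/-- **Differentials of elements with dual derivations are linearly independent**: if `δ_j ∈ Der_k(K)` satisfy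
`δ_j (z_{j'}) = δ_{jj'}` then `dz_j ∈ Ω_{K/k}` are `K`-linearly independent (apply the functional of `δ_j`).
[cite: Matsumura1987, Thm. 26.5] [folklore] -/
theorem linearIndependent_D_of_dual {k : Type u} {K : Type v} [Field k] [Field K] [Algebra k K]
    {ι' : Type w'} [Fintype ι'] [DecidableEq ι'] (z : ι' → K) (δ : ι' → Derivation k K K)
    (hδ : ∀ j j', δ j (z j') = if j' = j then 1 else 0) :
    LinearIndependent K fun j => D k K (z j) :=
  linearIndependent_of_dual _ (fun j => (δ j).liftKaehlerDifferential) fun j j' => by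
    rw [Derivation.liftKaehlerDifferential_comp_D, hδ]

/-- **A derivation small on generators of an ideal maps the ideal into itself**: if `D (x_i) ∈ I` for a generating
family `x` of `I` then `D I ⊆ I` (Leibniz). In the frame below the `u`-directions kill the parameters, so they are
`𝔪`-LOGARITHMIC. [folklore] -/
theorem derivation_map_le_of_apply_mem {R : Type u} {A : Type v} [CommRing R] [CommRing A] [Algebra R A]
    {ι : Type w} (x : ι → A) (I : Ideal A) (hx : Ideal.span (Set.range x) = I) (D : Derivation R A A)
    (hD : ∀ i, D (x i) ∈ I) {a : A} (ha : a ∈ I) : D a ∈ I := by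
  rw [← hx] at ha hD ⊢
  refine Submodule.span_induction ?_ ?_ ?_ ?_ ha
  · rintro _ ⟨i, rfl⟩
    exact hD i
  · rw [map_zero]; exact zero_mem _
  · intro a b _ _ ha hb
    rw [map_add]; exact add_mem ha hb
  · intro r a ha' hDa
    rw [smul_eq_mul, D.leibniz, smul_eq_mul, smul_eq_mul]
    exact add_mem (Ideal.mul_mem_left _ _ hDa) (Ideal.mul_mem_right _ _ ha')

/-! ## §1 The engine: split injectivity of `e_l ↦ d(x, u)_l` over a formally smooth local algebra -/

section Engine

variable {k : Type u} {A : Type v} [Field k] [CommRing A] [IsLocalRing A] [Algebra k A]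
  [Algebra.EssFiniteType k A] [Algebra.FormallySmooth k A] [Algebra.FormallySmooth k (ResidueField A)]

/-- **ENGINE.** For `A` local, essentially of finite type and formally smooth over a field `k`, with formally smooth
residue field `K`: if `x : ι → 𝔪` is a minimal generating family of `𝔪` and `u : ι' → A` has residues carrying
dual `k`-derivations `δ_j` of `K` (`δ_j (ū_{j'}) = δ_{jj'}`), then the `A`-linear map `A^{ι ⊕ ι'} → Ω_{A/k}`,
`e_l ↦ d((x, u)_l)`, has a retraction. (Fibrewise: `{1 ⊗ dx_i}` independent by the Jacobian criterion,
`{1 ⊗ du_j} ↦ {dū_j}` independent in `Ω_{K/k}`, and `K ⊗ Ω_{A/k} → Ω_{K/k}` kills the `x`-block; then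
`IsLocalRing.split_injective_iff_lTensor_residueField_injective`, `Ω_{A/k}` being finite free.)
[cite: Matsumura1987, Thm. 30.6 (ii)] [folklore] -/
theorem exists_retraction_sum {ι : Type w} {ι' : Type w'} [Fintype ι] [DecidableEq ι] [Fintype ι']
    [DecidableEq ι'] (x : ι → A) (hx : Ideal.span (Set.range x) = maximalIdeal A)
    (hcard : Fintype.card ι = (maximalIdeal A).spanFinrank) (u : ι' → A)
    (δ : ι' → Derivation k (ResidueField A) (ResidueField A))
    (hδ : ∀ j j', δ j (residue A (u j')) = if j' = j then 1 else 0) :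
    ∃ ρ : Ω[A⁄k] →ₗ[A] (ι ⊕ ι' → A),
      ρ ∘ₗ Fintype.linearCombination A (fun l => D k A (Sum.elim x u l)) = LinearMap.id := by
  classical
  haveI : Module.Free A Ω[A⁄k] := Module.free_of_flat_of_isLocalRing
  set K := ResidueField A
  -- the `x`-block retraction (tree, Jacobian criterion)
  obtain ⟨ρx, hρx⟩ := exists_retraction_of_formallySmooth (k := k) x hx hcard
  have hρxD : ∀ i, ρx (D k A (x i)) = Pi.single i 1 := by
    intro i
    have h := LinearMap.congr_fun hρx (Pi.single i 1)
    rwa [LinearMap.comp_apply, Fintype.linearCombination_apply_single, one_smul, LinearMap.id_apply] at h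
  set ψ : (ι ⊕ ι' → A) →ₗ[A] Ω[A⁄k] := Fintype.linearCombination A (fun l => D k A (Sum.elim x u l))
    with hψdef
  -- the fibre family
  let wx : ι → K ⊗[A] Ω[A⁄k] := fun i => (1 : K) ⊗ₜ[A] D k A (x i)
  let wu : ι' → K ⊗[A] Ω[A⁄k] := fun j => (1 : K) ⊗ₜ[A] D k A (u j)
  have hw_elim : ∀ l, Sum.elim wx wu l = (1 : K) ⊗ₜ[A] D k A (Sum.elim x u l) := by
    rintro (i | j) <;> rfl
  -- `β : K ⊗ Ω_{A/k} → Ω_{K/k}` kills the `x`-block and sends the `u`-block to `dū`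
  let β : K ⊗[A] Ω[A⁄k] →ₗ[K] Ω[K⁄k] := KaehlerDifferential.mapBaseChange k A K
  have hβ : ∀ a : A, β ((1 : K) ⊗ₜ[A] D k A a) = D k K (residue A a) := by
    intro a
    change KaehlerDifferential.mapBaseChange k A K ((1 : K) ⊗ₜ[A] D k A a) = _
    rw [KaehlerDifferential.mapBaseChange_tmul, one_smul, KaehlerDifferential.map_D,
      ResidueField.algebraMap_eq]
  have hβx : ∀ i, β (wx i) = 0 := by
    intro i
    change β ((1 : K) ⊗ₜ[A] D k A (x i)) = 0
    rw [hβ, (residue_eq_zero_iff (x i)).mpr (hx ▸ Ideal.subset_span ⟨i, rfl⟩), map_zero]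
  have hβu : ∀ j, β (wu j) = D k K (residue A (u j)) := fun j => hβ (u j)
  -- (a) the `x`-block is independent in the fibre
  have hwx : LinearIndependent K wx := by
    let Φ : K ⊗[A] Ω[A⁄k] →ₗ[K] (ι → K) :=
      (TensorProduct.piScalarRight A K K ι).toLinearMap ∘ₗ ρx.baseChange K
    refine LinearIndependent.of_comp Φ ?_
    have hΦ : Φ ∘ wx = fun i => Pi.single i (1 : K) := by
      funext i
      change TensorProduct.piScalarRight A K K ι (ρx.baseChange K ((1 : K) ⊗ₜ[A] D k A (x i))) = _
      rw [LinearMap.baseChange_tmul, hρxD, TensorProduct.piScalarRight_apply,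
        TensorProduct.piScalarRightHom_tmul]
      funext i'
      by_cases h : i' = i
      · subst h
        rw [Pi.single_eq_same, Pi.single_eq_same, one_smul]
      · rw [Pi.single_eq_of_ne h, Pi.single_eq_of_ne h, zero_smul]
    rw [hΦ]
    exact Pi.linearIndependent_single_one ι K
  -- (b) the `u`-block is independent in the fibre
  have hli : LinearIndependent K fun j => D k K (residue A (u j)) :=
    linearIndependent_D_of_dual _ δ hδ
  have hwu : LinearIndependent K wu := by
    refine LinearIndependent.of_comp β ?_
    have : β ∘ wu = fun j => D k K (residue A (u j)) := funext hβu
    rw [this]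
    exact hli
  -- (c) the two spans are disjoint
  have hdisj : Disjoint (Submodule.span K (Set.range wx)) (Submodule.span K (Set.range wu)) := by
    rw [Submodule.disjoint_def]
    intro z hzx hzu
    have hβz : β z = 0 := by
      have hle : Submodule.span K (Set.range wx) ≤ LinearMap.ker β := by
        rw [Submodule.span_le]
        rintro _ ⟨i, rfl⟩
        exact hβx i
      exact hle hzx
    obtain ⟨c, rfl⟩ := (Submodule.mem_span_range_iff_exists_fun K).mp hzu
    have hc : ∀ j, c j = 0 := by
      rw [Fintype.linearIndependent_iff] at hli
      apply hli
      rw [map_sum] at hβz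
      simpa only [map_smul, hβu] using hβz
    simp [hc]
  -- the whole fibre family is independent, so `K ⊗ ψ` is injective
  have hw : LinearIndependent K (Sum.elim wx wu) := hwx.sum_type hwu hdisj
  have hψinj : Function.Injective (ψ.lTensor K) := by
    rw [← LinearMap.baseChange_eq_ltensor]
    let e := TensorProduct.piScalarRight A K K (ι ⊕ ι')
    have hcomp : (ψ.baseChange K) ∘ₗ e.symm.toLinearMap =
        Fintype.linearCombination K (Sum.elim wx wu) := by
      apply LinearMap.pi_ext
      intro l c
      rw [LinearMap.comp_apply, LinearEquiv.coe_toLinearMap, TensorProduct.piScalarRight_symm_single,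
        LinearMap.baseChange_tmul, hψdef, Fintype.linearCombination_apply_single,
        Fintype.linearCombination_apply_single, one_smul, hw_elim, TensorProduct.smul_tmul', smul_eq_mul,
        mul_one]
    have hinj : Function.Injective ((ψ.baseChange K) ∘ₗ e.symm.toLinearMap) := by
      rw [hcomp]
      exact hw.fintypeLinearCombination_injective
    intro a b hab
    have h := @hinj (e a) (e b) (by
      simp only [LinearMap.comp_apply, LinearEquiv.coe_toLinearMap, LinearEquiv.symm_apply_apply]
      exact hab)
    exact e.injective h
  exact (IsLocalRing.split_injective_iff_lTensor_residueField_injective ψ).mpr hψinj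

/-- **FRAME FROM RESIDUE DUALS.** Under the hypotheses of `exists_retraction_sum` there are `k`-derivations
`∂_l ∈ Der_k(A)`, `l ∈ ι ⊕ ι'`, DUAL to the family `(x, u)`: `∂_l ((x,u)_{l'}) = δ_{ll'}` — i.e.
`∂_{x_i}(x_{i'}) = δ_{ii'}`, `∂_{x_i}(u_j) = 0`, `∂_{u_j}(x_i) = 0`, `∂_{u_j}(u_{j'}) = δ_{jj'}`.
[cite: Matsumura1987, Thm. 30.6 (ii)] [folklore] -/
theorem exists_frame_of_dual {ι : Type w} {ι' : Type w'} [Fintype ι] [DecidableEq ι] [Fintype ι']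
    [DecidableEq ι'] (x : ι → A) (hx : Ideal.span (Set.range x) = maximalIdeal A)
    (hcard : Fintype.card ι = (maximalIdeal A).spanFinrank) (u : ι' → A)
    (δ : ι' → Derivation k (ResidueField A) (ResidueField A))
    (hδ : ∀ j j', δ j (residue A (u j')) = if j' = j then 1 else 0) :
    ∃ der : ι ⊕ ι' → Derivation k A A, ∀ l l', der l (Sum.elim x u l') = if l' = l then 1 else 0 := by
  classical
  obtain ⟨ρ, hρ⟩ := exists_retraction_sum (k := k) x hx hcard u δ hδ
  have hρD : ∀ l', ρ (D k A (Sum.elim x u l')) = Pi.single l' 1 := by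
    intro l'
    have h := LinearMap.congr_fun hρ (Pi.single l' 1)
    rwa [LinearMap.comp_apply, Fintype.linearCombination_apply_single, one_smul, LinearMap.id_apply] at h
  refine ⟨fun l => (LinearMap.proj l ∘ₗ ρ).compDer (D k A), fun l l' => ?_⟩
  change (LinearMap.proj l ∘ₗ ρ) (D k A (Sum.elim x u l')) = _
  rw [LinearMap.comp_apply, hρD, LinearMap.proj_apply]
  by_cases h : l' = l
  · subst h; rw [Pi.single_eq_same, if_pos rfl]
  · rw [Pi.single_eq_of_ne' h, if_neg h]

end Engine

/-! ## §2 Over a perfect field: `p`-bases of the residue field and their dual derivations -/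

section Perfect

variable (p : ℕ) [Fact p.Prime]

/-- Over a perfect field `k` of characteristic `p`, every `ℤ`-derivation of a `k`-algebra `K` of characteristic
`p` KILLS `k`: `a = b^p` and `D(b^p) = p b^{p-1} D b = 0`. [folklore] -/
theorem derivation_algebraMap_eq_zero {k : Type u} {K : Type v} [Field k] [CharP k p] [PerfectField k]
    [Field K] [CharP K p] [Algebra k K] {M : Type w} [AddCommGroup M] [Module K M]
    (D : Derivation ℤ K M) (a : k) : D (algebraMap k K a) = 0 := by
  haveI : PerfectRing k p := PerfectField.toPerfectRing p
  have ha : algebraMap k K a = (algebraMap k K ((frobeniusEquiv k p).symm a)) ^ p := by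
    rw [← map_pow, frobeniusEquiv_symm_pow_p]
  rw [ha]
  exact Derivation.apply_pow_char (p := p) D _

/-- A `ℤ`-derivation of a field `K ⊇ k` that kills `k` IS a `k`-derivation (same underlying map). Over a perfect
ground field of characteristic `p` the hypothesis is automatic (`derivation_algebraMap_eq_zero`). [folklore] -/
theorem exists_derivation_of_int {k : Type u} {K : Type v} [Field k] [Field K] [Algebra k K]
    (D : Derivation ℤ K K) (hD : ∀ a : k, D (algebraMap k K a) = 0) :
    ∃ D' : Derivation k K K, ∀ z, D' z = D z := by
  let L : K →ₗ[k] K :=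
    { toFun := D
      map_add' := fun a b => map_add D a b
      map_smul' := fun a z => by
        rw [Algebra.smul_def, Derivation.leibniz, hD, smul_zero, add_zero, smul_eq_mul, RingHom.id_apply,
          Algebra.smul_def] }
  exact ⟨Derivation.mk' L fun a b => by
    change D (a * b) = a • D b + b • D a
    exact D.leibniz a b, fun z => rfl⟩

omit [Fact p.Prime] in
/-- The tree's `pAdjoin p T = K^p(T)` is the subfield generated by the `p`-th powers and `T` (definitional
unfolding, recorded so that consumers can read the instance-free spelling used in `exists_frame`). [folklore] -/
theorem pAdjoin_eq_closure {K : Type v} [Field K] [ExpChar K p] (T : Set K) :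
    pAdjoin p T = Subfield.closure (Set.range (fun y : K => y ^ p) ∪ T) := by
  rw [pAdjoin]
  congr

/-- **A finite `p`-basis with dual `k`-derivations and kernel exactly `K^p`**, for a field `K` finitely generated
over a perfect field `k` of characteristic `p`: there are `z₁, …, z_e ∈ K` with `K = K^p(z)`
(`pAdjoin p (range z) = ⊤`) and `δ_j ∈ Der_k(K)` with `δ_j (z_{j'}) = δ_{jj'}` and
`⋂ ker δ_j = K^p`. (A `p`-free subset of a finite generating set, tree `exists_isPFree_subset` /
`exists_dual_derivation` / `PBasisDual.mem_frobenius_of_forall_dual_eq_zero`.)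
[cite: Matsumura1987, §26 p. 202 and Thm. 26.5] [folklore] -/
theorem exists_pBasis_dual {k : Type u} {K : Type v} [Field k] [CharP k p] [PerfectField k] [Field K]
    [CharP K p] [Algebra k K] (hfg : (⊤ : IntermediateField k K).FG) :
    ∃ (e : ℕ) (z : Fin e → K) (δ : Fin e → Derivation k K K),
      pAdjoin p (Set.range z) = ⊤ ∧ (∀ j j', δ j (z j') = if j' = j then 1 else 0) ∧
        ∀ y : K, (∀ j, δ j y = 0) ↔ ∃ t : K, t ^ p = y := by
  classical
  haveI : ExpChar K p := ExpChar.prime Fact.out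
  obtain ⟨T, hT⟩ := hfg
  have hTtop := PBasisDual.pAdjoin_eq_top_of_adjoin_eq_top (k := k) p hT
  obtain ⟨S₀, -, hS₀, hTS₀⟩ := exists_isPFree_subset (p := p) T
  have hS₀top : pAdjoin p (↑S₀ : Set K) = ⊤ := PBasisDual.pAdjoin_eq_top_of_subset p hTtop hTS₀
  obtain ⟨δ₀, hδ₀⟩ := exists_dual_derivation hS₀
  -- index the `p`-basis by `Fin e`
  let ε := S₀.equivFin
  let z : Fin S₀.card → K := fun j => (ε.symm j : K)
  have hzmem : ∀ j, z j ∈ S₀ := fun j => (ε.symm j).2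
  have hrange : Set.range z = ↑S₀ := by
    ext y
    constructor
    · rintro ⟨j, rfl⟩; exact hzmem j
    · intro hy; exact ⟨ε ⟨y, hy⟩, by simp [z]⟩
  -- `k`-linear versions of the dual derivations
  have hk : ∀ j, ∃ D' : Derivation k K K, ∀ y, D' y = δ₀ (z j) y := fun j =>
    exists_derivation_of_int (δ₀ (z j)) fun a => derivation_algebraMap_eq_zero p (δ₀ (z j)) a
  choose δ hδ using hk
  refine ⟨S₀.card, z, δ, by rw [hrange, hS₀top], fun j j' => ?_, fun y => ⟨fun hy => ?_, ?_⟩⟩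
  · rw [hδ]
    by_cases h : j' = j
    · subst h; rw [if_pos rfl]; exact (hδ₀ _ (hzmem j')).1
    · rw [if_neg h]
      refine (hδ₀ _ (hzmem j)).2 _ (hzmem j') fun heq => h ?_
      exact ε.symm.injective (Subtype.ext heq)
  · -- common kernel ⊆ `K^p`
    refine PBasisDual.mem_frobenius_of_forall_dual_eq_zero p hδ₀ hS₀top fun s hs => ?_
    have h := hy (ε ⟨s, hs⟩)
    rw [hδ] at h
    simpa [z] using h
  · rintro ⟨t, rfl⟩ j
    rw [hδ]
    exact Derivation.apply_pow_char (p := p) _ t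

end Perfect

end Summit.ResolutionOfSingularities.ResolutionOfSingularities.Theorems.SwitchingDichotomy.MemberDerivationFrame

end
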